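import Summits.Ventures.Crystal3D.Theorems.StickyWulffConstantCoaxialWallLawSaturatedReaders
import Summits.Ventures.Crystal3D.Theorems.StickyWulffConstantGenericWallFloorStackWalkStarExclusion
import Summits.Ventures.Crystal3D.Theorems.StickyWulffConstantGenericWallFloorChamber
import Mathlib.Analysis.InnerProductSpace.Projection.Reflection
import HarnessLib

/-!
# Reader rigidity: two ADJACENT full readers read the same lattice
# (crux `CoaxialWallLaw`, stmt-Ventures-19481, line `WallLedgerF`; census-free brick for the OFF-MODULE tail)

HONEST FRAMING. Venture `Summits/Ventures/Crystal3D` (cell `crystal3d-full`), helper `--supports` the crux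
`CoaxialWallLaw` (stmt-Ventures-19481, `route-Ventures-StickyWulffConstant`), REGISTERED line `WallLedgerF` (planner
cf-p1, (lxxiv)(4): structure of the reader complex, memo HOME/wall-19481-p2/F-TAIL-g8.md §6 (b)/(c)).  Rung credit; F-C1
not moved; census-free.  The READERS of the (A) census row that are FULL (`IsFull X G q`: the twelve readings
`q + G·fccSlots` occupied) are saturated balls whose contacts are exactly their dozen (`contacts_eq_of_isFull`).  This
file proves the first rigidity rule of the reader complex:

* `exists_slot_triangle` — every slot lies in a slot triangle (two further slots pairwise at inner product `½`);
* **`movedFcc_eq_of_isFull_adjacent`** — in a `1`-separated `X`, two FULL balls `q₁` (frame `G₁`) and `q₂` (frame `G₂`)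
  at distance `1` have THE SAME linear lattice `G₁·Λ₀ = G₂·Λ₀` (`Λ₀ = fccStacking 1 √(2/3)`): the bond `q₁ − q₂` and two
  adjacent common neighbours give three linearly independent common unit vectors (`movedFcc_eq_of_three_independent_units`,
  lane G's dozen rigidity);
* `image_fccSlots_eq_of_isFull_adjacent` — hence the same slot dozen `G₁·fccSlots = G₂·fccSlots`: a connected cluster of
  adjacent full readers is a fragment of ONE lattice (one module), so NON-COAXIAL readers of a payer window (the
  «two-cluster junctions» of the off-module tail) never touch each other.
* **`movedFcc_eq_or_twin_of_isFull_isTwinReading_adjacent`** — a FULL ball `q₁` (frame `G₁`) adjacent to a TWIN READER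
  `q₂` (`IsTwinReading X G₂ m q₂`) has `G₁·Λ₀ = G₂·Λ₀` or `G₁·Λ₀ = (R_m G₂)·Λ₀` (the mirror twin across `m`): the same
  triangle of common contacts is read through `twin_contact_trichotomy` (in-plane / negative / mirror members; a negative
  member and a mirror are never adjacent, `inner_ne_half_of_neg_of_mirror`).  Either way both readers lie on ONE coaxial
  module with axis `m`.
WHAT THIS IS NOT: not the twin–twin rule, not the tail; F-C1 not moved.
-/

noncomputable section

namespace Summit.Ventures.Crystal3D.Theorems

open Summit.Ventures.Crystal3D Finset NearIdentity
open Literature.MathematicalPhysics.StatisticalMechanics (fccStacking)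
open scoped InnerProductSpace

/-- **Every slot lies in a slot triangle.** -/
theorem exists_slot_triangle {s : EuclideanSpace ℝ (Fin 3)} (hs : s ∈ fccSlots) :
    ∃ u₁ ∈ fccSlots, ∃ u₂ ∈ fccSlots, ⟪s, u₁⟫_ℝ = 1 / 2 ∧ ⟪s, u₂⟫_ℝ = 1 / 2 ∧ ⟪u₁, u₂⟫_ℝ = 1 / 2 := by
  obtain ⟨g, hg, -, hgs⟩ := exists_latticeIso_map_slot (slotSite_mem 0) hs
  refine ⟨g (slotSite 4), map_mem_fccSlots g hg (slotSite_mem 4), g (slotSite 8), map_mem_fccSlots g hg (slotSite_mem 8),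
    ?_, ?_, ?_⟩
  · rw [← hgs, LinearIsometryEquiv.inner_map_map, inner_slotSite,
      show slotInt 0 ⬝ᵥ slotInt 4 = 1 by decide]; norm_num
  · rw [← hgs, LinearIsometryEquiv.inner_map_map, inner_slotSite,
      show slotInt 0 ⬝ᵥ slotInt 8 = 1 by decide]; norm_num
  · rw [LinearIsometryEquiv.inner_map_map, inner_slotSite, show slotInt 4 ⬝ᵥ slotInt 8 = 1 by decide]; norm_num

section Full

variable {X : Finset (EuclideanSpace ℝ (Fin 3))} (hX : ∀ p ∈ X, ∀ q ∈ X, p ≠ q → 1 ≤ dist p q)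
include hX

/-- A unit vector `u` with `q + u ∈ X` lies on the lattice `G·Λ₀` when `q` is FULL in the frame `G` (it is a reading). -/
theorem mem_movedFcc_of_isFull_contact {G : EuclideanSpace ℝ (Fin 3) ≃ₗᵢ[ℝ] EuclideanSpace ℝ (Fin 3)}
    {q u : EuclideanSpace ℝ (Fin 3)} (h : IsFull X G q) (hu : ‖u‖ = 1) (hmem : q + u ∈ X) :
    u ∈ G '' fccStacking 1 (Real.sqrt (2 / 3)) := by
  obtain ⟨w, hw, he⟩ := mem_frame_of_contact_of_isFull hX h hmem (by rw [dist_eq_norm]; simpa using hu)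
  have : u = G w := add_left_cancel he
  exact ⟨w, mem_fcc_of_mem_fccSlots hw, this.symm⟩

/-- **ADJACENT FULL READERS READ THE SAME LATTICE.**  In a `1`-separated configuration, two balls `q₁, q₂ ∈ X` that are
FULL in the frames `G₁`, `G₂` and touch have `G₁·Λ₀ = G₂·Λ₀`. -/
theorem movedFcc_eq_of_isFull_adjacent {G₁ G₂ : EuclideanSpace ℝ (Fin 3) ≃ₗᵢ[ℝ] EuclideanSpace ℝ (Fin 3)}
    {q₁ q₂ : EuclideanSpace ℝ (Fin 3)} (hq₁ : q₁ ∈ X) (hq₂ : q₂ ∈ X) (h₁ : IsFull X G₁ q₁) (h₂ : IsFull X G₂ q₂)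
    (hd : dist q₁ q₂ = 1) :
    G₁ '' fccStacking 1 (Real.sqrt (2 / 3)) = G₂ '' fccStacking 1 (Real.sqrt (2 / 3)) := by
  -- the bond is a `G₁`-slot
  obtain ⟨w, hw, hq₂e⟩ := mem_frame_of_contact_of_isFull hX h₁ hq₂ hd
  have hnw : -w ∈ fccSlots := neg_mem_fccSlots hw
  -- a slot triangle at `−w`
  obtain ⟨u₁, hu₁, u₂, hu₂, h01, h02, h12⟩ := exists_slot_triangle hnw
  -- the two triangle readings of `q₁` through `w + uᵢ` are common neighbours
  have hwu : ∀ {u}, u ∈ fccSlots → ⟪-w, u⟫_ℝ = 1 / 2 → q₂ + G₁ u ∈ X := by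
    intro u hu hin
    have hslot : w + u ∈ fccSlots :=
      add_mem_fccSlots_of_inner_eq_neg_half hw hu (by rw [inner_neg_left] at hin; linarith)
    have := h₁ (w + u) hslot
    rwa [map_add, ← add_assoc, ← hq₂e] at this
  have hb : q₂ + G₁ (-w) ∈ X := by rw [map_neg, hq₂e]; simpa using hq₁
  -- three independent common unit vectors
  have n0 : ‖G₁ (-w)‖ = 1 := by rw [LinearIsometryEquiv.norm_map, norm_eq_one_of_mem_fccSlots hnw]
  have n1 : ‖G₁ u₁‖ = 1 := by rw [LinearIsometryEquiv.norm_map, norm_eq_one_of_mem_fccSlots hu₁]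
  have n2 : ‖G₁ u₂‖ = 1 := by rw [LinearIsometryEquiv.norm_map, norm_eq_one_of_mem_fccSlots hu₂]
  have hind : LinearIndependent ℝ ![G₁ (-w), G₁ u₁, G₁ u₂] :=
    linearIndependent_map_triple G₁ (linearIndependent_of_pairwise_half hnw hu₁ hu₂ h01 h02 h12)
  exact movedFcc_eq_of_three_independent_units G₁ G₂ ⟨-w, mem_fcc_of_mem_fccSlots hnw, rfl⟩
    ⟨u₁, mem_fcc_of_mem_fccSlots hu₁, rfl⟩ ⟨u₂, mem_fcc_of_mem_fccSlots hu₂, rfl⟩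
    (mem_movedFcc_of_isFull_contact hX h₂ n0 hb) (mem_movedFcc_of_isFull_contact hX h₂ n1 (hwu hu₁ h01))
    (mem_movedFcc_of_isFull_contact hX h₂ n2 (hwu hu₂ h02)) n0 n1 n2 hind

/-- **Hence adjacent full readers have the same slot dozen.** -/
theorem image_fccSlots_eq_of_isFull_adjacent {G₁ G₂ : EuclideanSpace ℝ (Fin 3) ≃ₗᵢ[ℝ] EuclideanSpace ℝ (Fin 3)}
    {q₁ q₂ : EuclideanSpace ℝ (Fin 3)} (hq₁ : q₁ ∈ X) (hq₂ : q₂ ∈ X) (h₁ : IsFull X G₁ q₁) (h₂ : IsFull X G₂ q₂)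
    (hd : dist q₁ q₂ = 1) :
    (G₁ : EuclideanSpace ℝ (Fin 3) → EuclideanSpace ℝ (Fin 3)) '' ↑fccSlots =
      (G₂ : EuclideanSpace ℝ (Fin 3) → EuclideanSpace ℝ (Fin 3)) '' ↑fccSlots :=
  image_fccSlots_eq_of_image_fcc_eq G₁ G₂ (movedFcc_eq_of_isFull_adjacent hX hq₁ hq₂ h₁ h₂ hd)

/-- **A chain of adjacent full readers reads one lattice**: if `q₀, …, qₙ ∈ X` are FULL in frames `G 0, …, G n` and
consecutive ones touch, then `G 0·Λ₀ = G n·Λ₀`. -/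
theorem movedFcc_eq_of_isFull_chain {n : ℕ} (G : ℕ → (EuclideanSpace ℝ (Fin 3) ≃ₗᵢ[ℝ] EuclideanSpace ℝ (Fin 3)))
    (q : ℕ → EuclideanSpace ℝ (Fin 3)) (hq : ∀ i ≤ n, q i ∈ X) (hfull : ∀ i ≤ n, IsFull X (G i) (q i))
    (hadj : ∀ i < n, dist (q i) (q (i + 1)) = 1) :
    G 0 '' fccStacking 1 (Real.sqrt (2 / 3)) = G n '' fccStacking 1 (Real.sqrt (2 / 3)) := by
  induction n with
  | zero => rfl
  | succ k ih =>
    rw [ih (fun i hi => hq i (Nat.le_succ_of_le hi)) (fun i hi => hfull i (Nat.le_succ_of_le hi))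
      (fun i hi => hadj i (Nat.lt_succ_of_lt hi))]
    exact movedFcc_eq_of_isFull_adjacent hX (hq k (Nat.le_succ k)) (hq (k + 1) le_rfl) (hfull k (Nat.le_succ k))
      (hfull (k + 1) le_rfl) (hadj k (Nat.lt_succ_self k))

/-! ### A full reader adjacent to a twin reader -/

omit hX in
/-- Menu bookkeeping: a negative reading of a twin normal is `−√(2/3)`. -/
theorem inner_eq_neg_sqrt_of_neg {G : EuclideanSpace ℝ (Fin 3) ≃ₗᵢ[ℝ] EuclideanSpace ℝ (Fin 3)} {m w : EuclideanSpace ℝ (Fin 3)}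
    (hm : IsMenuNormal G m) (hw : w ∈ fccSlots) (hneg : ⟪G w, m⟫_ℝ < 0) : ⟪G w, m⟫_ℝ = -Real.sqrt (2 / 3) := by
  have hs : 0 < Real.sqrt (2 / 3) := Real.sqrt_pos.2 (by norm_num)
  rcases hm.2 w hw with h | h | h
  · linarith
  · linarith
  · exact h

omit hX in
/-- **A negative slot member and a mirror member of a twin dozen are never adjacent**:
`⟪G w, G w' − 2⟪G w', m⟫ m⟫ = ⟪w, w'⟫ − 4/3 < ½`. -/
theorem inner_ne_half_of_neg_of_mirror {G : EuclideanSpace ℝ (Fin 3) ≃ₗᵢ[ℝ] EuclideanSpace ℝ (Fin 3)}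
    {m w w' : EuclideanSpace ℝ (Fin 3)} (hm : IsMenuNormal G m) (hw : w ∈ fccSlots) (hw' : w' ∈ fccSlots)
    (hneg : ⟪G w, m⟫_ℝ < 0) (hneg' : ⟪G w', m⟫_ℝ < 0) :
    ⟪G w, G w' - (2 * ⟪G w', m⟫_ℝ) • m⟫_ℝ ≠ 1 / 2 := by
  have h23 : Real.sqrt (2 / 3) ^ 2 = 2 / 3 := Real.sq_sqrt (by norm_num)
  have e := inner_eq_neg_sqrt_of_neg hm hw hneg
  have e' := inner_eq_neg_sqrt_of_neg hm hw' hneg'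
  have hcs : ⟪w, w'⟫_ℝ ≤ 1 := by
    have := real_inner_le_norm w w'
    rw [norm_eq_one_of_mem_fccSlots hw, norm_eq_one_of_mem_fccSlots hw'] at this; linarith
  rw [inner_sub_right, inner_smul_right, LinearIsometryEquiv.inner_map_map, e, e']
  nlinarith [h23]

/-- **Trichotomy of a contact of a twin reader.**  A unit `v` with `q + v ∈ X`, `q` a twin reader for `(G, m)`, is an
IN-PLANE reading (on both lattices `G·Λ₀` and `(R_m G)·Λ₀`), a NEGATIVE reading (on `G·Λ₀`), or a MIRROR (on
`(R_m G)·Λ₀`), where `R_m G = G.trans ((ℝ ∙ m)ᗮ.reflection)`. -/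
theorem twin_contact_trichotomy {G : EuclideanSpace ℝ (Fin 3) ≃ₗᵢ[ℝ] EuclideanSpace ℝ (Fin 3)}
    {m q v : EuclideanSpace ℝ (Fin 3)} (h : IsTwinReading X G m q) (hv : ‖v‖ = 1) (hmem : q + v ∈ X) :
    (v ∈ G '' fccStacking 1 (Real.sqrt (2 / 3)) ∧ v ∈ (G.trans (ℝ ∙ m)ᗮ.reflection) '' fccStacking 1 (Real.sqrt (2 / 3))) ∨
    (v ∈ G '' fccStacking 1 (Real.sqrt (2 / 3)) ∧ ∃ w ∈ fccSlots, ⟪G w, m⟫_ℝ < 0 ∧ v = G w) ∨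
    (v ∈ (G.trans (ℝ ∙ m)ᗮ.reflection) '' fccStacking 1 (Real.sqrt (2 / 3)) ∧
      ∃ w ∈ fccSlots, ⟪G w, m⟫_ℝ < 0 ∧ v = G w - (2 * ⟪G w, m⟫_ℝ) • m) := by
  have hm1 : ‖m‖ = 1 := h.1.1
  have hrefl : ∀ w, (G.trans (ℝ ∙ m)ᗮ.reflection) w = G w - (2 * ⟪G w, m⟫_ℝ) • m := fun w => by
    rw [LinearIsometryEquiv.trans_apply, reflection_unit_apply hm1]
  rcases mem_twinDozen_of_contact_of_isTwinReading hX h hmem (by rw [dist_eq_norm]; simpa using hv) with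
    ⟨w, hw, hle, he⟩ | ⟨w, hw, hlt, he⟩
  · have hvw : v = G w := add_left_cancel he
    have hP : v ∈ G '' fccStacking 1 (Real.sqrt (2 / 3)) := ⟨w, mem_fcc_of_mem_fccSlots hw, hvw.symm⟩
    rcases hle.lt_or_eq with hlt | hz
    · exact Or.inr (Or.inl ⟨hP, w, hw, hlt, hvw⟩)
    · refine Or.inl ⟨hP, w, mem_fcc_of_mem_fccSlots hw, ?_⟩
      rw [hrefl, hz, hvw]; simp
  · have hvw : v = G w - (2 * ⟪G w, m⟫_ℝ) • m := add_left_cancel he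
    refine Or.inr (Or.inr ⟨⟨w, mem_fcc_of_mem_fccSlots hw, by rw [hrefl, hvw]⟩, w, hw, hlt, hvw⟩)

/-- **A FULL READER ADJACENT TO A TWIN READER reads the twin reader's lattice or its mirror twin.**  In a
`1`-separated configuration, if `q₁ ∈ X` is FULL in the frame `G₁`, `q₂ ∈ X` is a twin reader for `(G₂, m)`, and they
touch, then `G₁·Λ₀ = G₂·Λ₀` or `G₁·Λ₀ = (R_m G₂)·Λ₀` — in either case the two readers lie on ONE coaxial module with
axis `m`. -/
theorem movedFcc_eq_or_twin_of_isFull_isTwinReading_adjacent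
    {G₁ G₂ : EuclideanSpace ℝ (Fin 3) ≃ₗᵢ[ℝ] EuclideanSpace ℝ (Fin 3)} {m q₁ q₂ : EuclideanSpace ℝ (Fin 3)}
    (hq₁ : q₁ ∈ X) (h₁ : IsFull X G₁ q₁) (h₂ : IsTwinReading X G₂ m q₂) (hq₂ : q₂ ∈ X) (hd : dist q₁ q₂ = 1) :
    G₁ '' fccStacking 1 (Real.sqrt (2 / 3)) = G₂ '' fccStacking 1 (Real.sqrt (2 / 3)) ∨
    G₁ '' fccStacking 1 (Real.sqrt (2 / 3)) = (G₂.trans (ℝ ∙ m)ᗮ.reflection) '' fccStacking 1 (Real.sqrt (2 / 3)) := by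
  -- the bond is a `G₁`-slot; a slot triangle at `−w` gives three common unit vectors pairwise at `60°`
  obtain ⟨w, hw, hq₂e⟩ := mem_frame_of_contact_of_isFull hX h₁ hq₂ hd
  have hnw : -w ∈ fccSlots := neg_mem_fccSlots hw
  obtain ⟨u₁, hu₁, u₂, hu₂, h01, h02, h12⟩ := exists_slot_triangle hnw
  have hwu : ∀ {u}, u ∈ fccSlots → ⟪-w, u⟫_ℝ = 1 / 2 → q₂ + G₁ u ∈ X := by
    intro u hu hin
    have hslot : w + u ∈ fccSlots :=
      add_mem_fccSlots_of_inner_eq_neg_half hw hu (by rw [inner_neg_left] at hin; linarith)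
    have := h₁ (w + u) hslot
    rwa [map_add, ← add_assoc, ← hq₂e] at this
  have hb : q₂ + G₁ (-w) ∈ X := by rw [map_neg, hq₂e]; simpa using hq₁
  have n0 : ‖G₁ (-w)‖ = 1 := by rw [LinearIsometryEquiv.norm_map, norm_eq_one_of_mem_fccSlots hnw]
  have n1 : ‖G₁ u₁‖ = 1 := by rw [LinearIsometryEquiv.norm_map, norm_eq_one_of_mem_fccSlots hu₁]
  have n2 : ‖G₁ u₂‖ = 1 := by rw [LinearIsometryEquiv.norm_map, norm_eq_one_of_mem_fccSlots hu₂]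
  have hind : LinearIndependent ℝ ![G₁ (-w), G₁ u₁, G₁ u₂] :=
    linearIndependent_map_triple G₁ (linearIndependent_of_pairwise_half hnw hu₁ hu₂ h01 h02 h12)
  have i01 : ⟪G₁ (-w), G₁ u₁⟫_ℝ = 1 / 2 := by rw [LinearIsometryEquiv.inner_map_map, h01]
  have i02 : ⟪G₁ (-w), G₁ u₂⟫_ℝ = 1 / 2 := by rw [LinearIsometryEquiv.inner_map_map, h02]
  have i12 : ⟪G₁ u₁, G₁ u₂⟫_ℝ = 1 / 2 := by rw [LinearIsometryEquiv.inner_map_map, h12]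
  have m0 : G₁ (-w) ∈ G₁ '' fccStacking 1 (Real.sqrt (2 / 3)) := ⟨-w, mem_fcc_of_mem_fccSlots hnw, rfl⟩
  have m1 : G₁ u₁ ∈ G₁ '' fccStacking 1 (Real.sqrt (2 / 3)) := ⟨u₁, mem_fcc_of_mem_fccSlots hu₁, rfl⟩
  have m2 : G₁ u₂ ∈ G₁ '' fccStacking 1 (Real.sqrt (2 / 3)) := ⟨u₂, mem_fcc_of_mem_fccSlots hu₂, rfl⟩
  -- the trichotomy of the three contacts of the twin reader
  have t0 := twin_contact_trichotomy hX h₂ n0 hb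
  have t1 := twin_contact_trichotomy hX h₂ n1 (hwu hu₁ h01)
  have t2 := twin_contact_trichotomy hX h₂ n2 (hwu hu₂ h02)
  -- a negative reading and a mirror are never adjacent
  have K : ∀ {v v' : EuclideanSpace ℝ (Fin 3)}, ⟪v, v'⟫_ℝ = 1 / 2 →
      (∃ w ∈ fccSlots, ⟪G₂ w, m⟫_ℝ < 0 ∧ v = G₂ w) →
      (∃ w ∈ fccSlots, ⟪G₂ w, m⟫_ℝ < 0 ∧ v' = G₂ w - (2 * ⟪G₂ w, m⟫_ℝ) • m) → False := by
    rintro v v' hin ⟨a, ha, hna, rfl⟩ ⟨a', ha', hna', rfl⟩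
    exact inner_ne_half_of_neg_of_mirror h₂.1 ha ha' hna hna' hin
  have K' : ∀ {v v' : EuclideanSpace ℝ (Fin 3)}, ⟪v, v'⟫_ℝ = 1 / 2 →
      (∃ w ∈ fccSlots, ⟪G₂ w, m⟫_ℝ < 0 ∧ v' = G₂ w) →
      (∃ w ∈ fccSlots, ⟪G₂ w, m⟫_ℝ < 0 ∧ v = G₂ w - (2 * ⟪G₂ w, m⟫_ℝ) • m) → False := by
    intro v v' hin hN hM
    exact K (by rw [real_inner_comm]; exact hin) hN hM
  set Λ₁ := G₁ '' fccStacking 1 (Real.sqrt (2 / 3))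
  set Λ₂ := G₂ '' fccStacking 1 (Real.sqrt (2 / 3))
  set Λ₂' := (G₂.trans (ℝ ∙ m)ᗮ.reflection) '' fccStacking 1 (Real.sqrt (2 / 3))
  -- either all three contacts lie on `Λ₂`, or all three on `Λ₂'`
  have key : (G₁ (-w) ∈ Λ₂ ∧ G₁ u₁ ∈ Λ₂ ∧ G₁ u₂ ∈ Λ₂) ∨ (G₁ (-w) ∈ Λ₂' ∧ G₁ u₁ ∈ Λ₂' ∧ G₁ u₂ ∈ Λ₂') := by
    rcases t0 with ⟨p0, q0⟩ | ⟨p0, N0⟩ | ⟨q0, M0⟩ <;>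
    rcases t1 with ⟨p1, q1⟩ | ⟨p1, N1⟩ | ⟨q1, M1⟩ <;>
    rcases t2 with ⟨p2, q2⟩ | ⟨p2, N2⟩ | ⟨q2, M2⟩
    all_goals first
      | exact Or.inl ⟨p0, p1, p2⟩
      | exact Or.inr ⟨q0, q1, q2⟩
      | exact (K i01 N0 M1).elim | exact (K' i01 N1 M0).elim
      | exact (K i02 N0 M2).elim | exact (K' i02 N2 M0).elim
      | exact (K i12 N1 M2).elim | exact (K' i12 N2 M1).elim
  rcases key with ⟨a0, a1, a2⟩ | ⟨a0, a1, a2⟩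
  · exact Or.inl (movedFcc_eq_of_three_independent_units G₁ G₂ m0 m1 m2 a0 a1 a2 n0 n1 n2 hind)
  · exact Or.inr (movedFcc_eq_of_three_independent_units G₁ _ m0 m1 m2 a0 a1 a2 n0 n1 n2 hind)

end Full


end Summit.Ventures.Crystal3D.Theorems

end
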